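import Summits.QuantumFields.BalabanUV.Beta.NVertexEvenBorder
import Summits.QuantumFields.BalabanUV.Beta.NVertexWoundTorus
import Summits.QuantumFields.BalabanUV.Beta.NVertexWoundFoldAssembly
import Summits.QuantumFields.BalabanUV.Beta.FP.BiVertexDressSym

/-!
# `BalabanUV.Beta.NVertexEvenBorderTorus` — row D1 ∕ (C1), PART 20: **THE 𝔔-ROW's RIGHT SIDE ON THE TORUS: `perF T (dper T (wound WN♮))` ON THE MULTIPLIER–FIELD BLOCK IS
# `−Pn.cB(j+1) ·` THE PRODUCT-FORM WOUND DOUBLE FOLD OF THE COMPOSITE ROW-BORDER TABLE `compVh2Sˢ`** — PART 19's entry formula collapsed to ONE orientation (the sym-brick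
# composite second-order kernel is symmetric in its two background bonds: `compVH2Ker_swap`), carried through `Σ'_e`, `dper`, `perF` (fibre-entrywise), and folded by PART 14b
# `perF_dper_tsum_vertex2OfK_translate` at `K := AN R j`, `S₂ := compVh2Sˢ` — road «FP» g44 A-4 l.67810: «PART 20 BY THE ROW: WANTED», the input of `FP/TowerQN2Row.hQN2_of_lock`

WHAT ([folklore] bookkeeping BY NAME; no `def`, no `def … : Prop`, nothing cited, 0 sorry): §1 `sum4_comm`, **`compVH2Ker_swap`** (generic bricks, symmetric top second-order brick),
`compVh2S_swap`, `s2periodCov_of_shiftK_cov`, `perF_dper_apply_congr_entry`; §2 at the N record **`WN_evenHalf_apply_inr_inl_one`** (PART 19 + `FP/BiVertexDressSym.half_sum_vertex2OfK_of_symm`),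
**`perF_dper_wound_WN_evenHalf_inr_inl`**, **`perF_dper_wound_WN_evenHalf_inr_inl_eq_sum`** (the product form: `Σ_b Σ_β Θ_b(μ,y)·Θ_β(ν,y′) • perF M (dper M (x z ↦ Σ'_n compVh2Sˢ b.2 b.1 β.2 (β.1+M∘n) x z))`,
`Θ_b(μ,y) = (perF M (AN R j)) ((b.1, inl b.2), (wrapPt M (N•y), inr μ))` = road (H)'s `colN̂`; (H)'s table at `(b, β)` is `compVh2Sˢ` by `rfl` — probe `gen68/cert/PROBE-H-bricks-defeq`).
CONSEQUENCE: with road (H) `Qprime2_symm_apply_eq_sum_sum_perF_dper_copies` (LEFT = `(c²·r·r·Σ_full) ·` the SAME double sum) v5's `hQN₂` follows from the ONE lock row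
`(c n)²·r·r·Σ_full = −Pn.cB (n+2)` (road's `hQN2_of_lock`); conversely the row forces the lock wherever the border form is nonzero.
WHAT THIS IS NOT: no value of `Pn.cB` asserted (the lock is a displayed junction condition on a FREE pin); not the H row; nothing of Bałaban's asserted, valued or discharged;
0 estimates; 0∕4 row-D1 binders (hW, hR, D1Tel, D1Rep); ROOT M‴ p325680 ∕ P5c ∕ D6 untouched; NOT (C1), NOT (T-ID), NOT D1, NEVER «G-an2-4 closed», NOT BetaPertH, NOT continuum, NOT Clay.

HONEST DEPENDENCY (page 1, mandatory): continuum YM on T⁴ ⇐ BetaPertH ∧ nine spine estimates (0/9 proved); BetaPertH ⇐ (D1) ∧ (D4) ∧ CAP+tail;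
G-an2-4 gates asym, D1 and NE2/3/4.  HONEST FRAMING (cell contract, verbatim): «discharging `BetaPertH` makes Bałaban's UV stability UNCONDITIONAL —
a real constructive-QFT result; it is NOT the continuum limit and NOT the Clay problem.»  ABSOLUTE RULE (cell charter, verbatim): «No internally-minted
statement may enter as a cited fact. Every hypothesis is either kernel-proved in this package or a verbatim quotation of a PUBLISHED theorem with page
reference. The manuscript(s) under audit are NOT citable for their own disputed steps — they are the thing under adjudication; programme-internal
(2001/route/tribunal) claims are never citable.»  Row D1 ∕ (C1) OWNER an2 (b2b-balaban-beta-an2) gen 68, 2026-08-27.  No existing file touched.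
-/

noncomputable section

open scoped BigOperators

namespace Summit.QuantumFields.BalabanUV.Beta.NVertexEvenBorderTorus

open Finset
open Literature.MathematicalPhysics.QuantumFieldTheory
open Literature.MathematicalPhysics.QuantumFieldTheory.Balaban1983to89
open Literature.MathematicalPhysics.QuantumFieldTheory.Balaban1983to89.Beta
open B4TorusKernel.MultiPeriod (translate translate_apply)
open B6Lemma24Torus (pbox)
open ExpKernelCalculus (MKer Decays BiLoc shiftK)
open AffineAveraging (Site box toSite)
open AveragingHessianKernels (Bond packVH packVH_inl_inr packVH_inr_inl packVH_inl_inl packVH_inr_inr)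
open OneStepResolventKernel (Fib)
open OneStepKernelFamily (vertexOfK)
open BalabanCompositeJets (LocStencil₂)
open SecondOrderResponse (vertex2OfK)
open Summit.QuantumFields.BalabanUV.Beta.TameKernelCalculus (trK)
open Summit.QuantumFields.BalabanUV.Beta.BorderedHessian (sgnF sgnK)
open Summit.QuantumFields.BalabanUV.Beta.AxialDressingRooted (one_le_of_neZero)
open Summit.QuantumFields.BalabanUV.Beta.SecondOrderRemainderTables (abs_le_of_locStencil₂)
open Summit.QuantumFields.BalabanUV.Beta.SymAveragingHessianCounts (symLinKerAt symVhKerAt)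
open Summit.QuantumFields.BalabanUV.Beta.CompositeVertexKernelRec (offs compLinKer compVHKer compVH2Ker compVH2Ker_zero compVH2Ker_succ compVh2S)
open Summit.QuantumFields.BalabanUV.Beta.CompositeVertexKernelBoundsTwoSym (symVh2KerSymAt symVh2KerSymAt_swap locStencil₂_compVh2S_symSym compVh2S_symSym_translate)
open Summit.QuantumFields.BalabanUV.Beta.CompositeOneShotJets (tabsComp)
open Summit.QuantumFields.BalabanUV.Beta.CompositeOneShotJetData (Roots Pins AN AN_eq WN)
open Summit.QuantumFields.BalabanUV.Beta.NVertexSectors (decays_AN)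
open Summit.QuantumFields.BalabanUV.Beta.FP.KernelPeriodisationFib (Idx perF perF_apply perZ_apply perF_smul translate_eq_add)
open Summit.QuantumFields.BalabanUV.Beta.FP.KernelPeriodisationFibLoc (dper dper_apply)
open Summit.QuantumFields.BalabanUV.Beta.FP.PeriodisedBorderTables (dper_smul)
open Summit.QuantumFields.BalabanUV.Beta.FP.TorusGaugeCovariancePairing (wrapPt)
open Summit.QuantumFields.BalabanUV.Beta.FP.BiVertexDressSym (half_sum_vertex2OfK_of_symm)
open Summit.QuantumFields.BalabanUV.Beta.CombHId2CopySum (nsmul_per)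
open Summit.QuantumFields.BalabanUV.Beta.NVertexWoundFoldAssembly (perF_dper_tsum_vertex2OfK_translate)
open Summit.QuantumFields.BalabanUV.Beta.NVertexWoundTorus (translate_inv_AN)
open Summit.QuantumFields.BalabanUV.Beta.NVertexEvenBorder (WN_evenHalf_apply_inr_inl)

variable {d : ℕ}

/-! ## §1 Generic letters -/

section Generic

/-- [folklore] reordering a 2×2-nested finite sum: `Σ_a Σ_b Σ_{a′} Σ_{b′} Φ a b a′ b′ = Σ_{a′} Σ_{b′} Σ_a Σ_b Φ a b a′ b′`. -/
theorem sum4_comm {α β : Type*} (s : Finset α) (t : Finset β) (Φ : α → β → α → β → ℝ) :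
    (∑ a ∈ s, ∑ b ∈ t, ∑ a' ∈ s, ∑ b' ∈ t, Φ a b a' b') = ∑ a' ∈ s, ∑ b' ∈ t, ∑ a ∈ s, ∑ b ∈ t, Φ a b a' b' := by
  have h1 : (∑ a ∈ s, ∑ b ∈ t, ∑ a' ∈ s, ∑ b' ∈ t, Φ a b a' b') = ∑ p ∈ s ×ˢ t, ∑ q ∈ s ×ˢ t, Φ p.1 p.2 q.1 q.2 := by
    rw [Finset.sum_product]
    exact Finset.sum_congr rfl fun a _ => Finset.sum_congr rfl fun b _ => by rw [Finset.sum_product]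
  have h2 : (∑ a' ∈ s, ∑ b' ∈ t, ∑ a ∈ s, ∑ b ∈ t, Φ a b a' b') = ∑ q ∈ s ×ˢ t, ∑ p ∈ s ×ˢ t, Φ p.1 p.2 q.1 q.2 := by
    rw [Finset.sum_product]
    exact Finset.sum_congr rfl fun a' _ => Finset.sum_congr rfl fun b' _ => by rw [Finset.sum_product]
  rw [h1, h2, Finset.sum_comm]

variable {ℓ : ℕ → Fin (d + 1) → Site (d + 1) → Bond (d + 1) → ℝ}
  {𝓋 : ℕ → Fin (d + 1) → Site (d + 1) → Bond (d + 1) → Bond (d + 1) → ℝ}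
  {𝓋₂ : ℕ → Fin (d + 1) → Site (d + 1) → Bond (d + 1) → Bond (d + 1) → Bond (d + 1) → ℝ} {L : ℕ}

/-- [folklore] **`compVH2Ker_swap` — an2's composite second-order border kernel is SYMMETRIC in its two background bonds when the top second-order brick is**
(induction on the top-peeled chain rule `compVH2Ker_succ`: the top-brick summand by relabelling the two background window sums (`sum4_comm`), the two mixed summands
exchange, the tail by the induction hypothesis). -/
theorem compVH2Ker_swap (h𝓋₂ : ∀ m μ y g g₁ g₂, 𝓋₂ m μ y g g₂ g₁ = 𝓋₂ m μ y g g₁ g₂) :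
    ∀ (m : ℕ) (μ : Fin (d + 1)) (y : Site (d + 1)) (f b b' : Bond (d + 1)),
      compVH2Ker ℓ 𝓋 𝓋₂ L m μ y f b' b = compVH2Ker ℓ 𝓋 𝓋₂ L m μ y f b b'
  | 0, μ, y, f, b, b' => by simp only [compVH2Ker_zero]
  | m + 1, μ, y, f, b, b' => by
    rw [compVH2Ker_succ, compVH2Ker_succ]
    have hT1 : (∑ κ : Fin (d + 1), ∑ e ∈ offs L, ∑ κ' : Fin (d + 1), ∑ e' ∈ offs L, ∑ κ'' : Fin (d + 1), ∑ e'' ∈ offs L,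
          𝓋₂ m μ y (κ, (L : ℤ) • y + e) (κ', (L : ℤ) • y + e') (κ'', (L : ℤ) • y + e'')
            * compLinKer ℓ L m f (κ, (L : ℤ) • y + e) * compLinKer ℓ L m b' (κ', (L : ℤ) • y + e')
            * compLinKer ℓ L m b (κ'', (L : ℤ) • y + e''))
        = ∑ κ : Fin (d + 1), ∑ e ∈ offs L, ∑ κ' : Fin (d + 1), ∑ e' ∈ offs L, ∑ κ'' : Fin (d + 1), ∑ e'' ∈ offs L,
          𝓋₂ m μ y (κ, (L : ℤ) • y + e) (κ', (L : ℤ) • y + e') (κ'', (L : ℤ) • y + e'')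
            * compLinKer ℓ L m f (κ, (L : ℤ) • y + e) * compLinKer ℓ L m b (κ', (L : ℤ) • y + e')
            * compLinKer ℓ L m b' (κ'', (L : ℤ) • y + e'') := by
      refine Finset.sum_congr rfl fun κ _ => Finset.sum_congr rfl fun e _ => ?_
      rw [sum4_comm (Finset.univ : Finset (Fin (d + 1))) (offs L) (fun κ' e' κ'' e'' =>
        𝓋₂ m μ y (κ, (L : ℤ) • y + e) (κ', (L : ℤ) • y + e') (κ'', (L : ℤ) • y + e'')
          * compLinKer ℓ L m f (κ, (L : ℤ) • y + e) * compLinKer ℓ L m b' (κ', (L : ℤ) • y + e')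
          * compLinKer ℓ L m b (κ'', (L : ℤ) • y + e''))]
      refine Finset.sum_congr rfl fun κ' _ => Finset.sum_congr rfl fun e' _ => Finset.sum_congr rfl fun κ'' _ =>
        Finset.sum_congr rfl fun e'' _ => ?_
      rw [h𝓋₂]
      ring
    have hT4 : (∑ κ : Fin (d + 1), ∑ e ∈ offs L, ℓ m μ y (κ, (L : ℤ) • y + e) * compVH2Ker ℓ 𝓋 𝓋₂ L m κ ((L : ℤ) • y + e) f b' b)
        = ∑ κ : Fin (d + 1), ∑ e ∈ offs L, ℓ m μ y (κ, (L : ℤ) • y + e) * compVH2Ker ℓ 𝓋 𝓋₂ L m κ ((L : ℤ) • y + e) f b b' :=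
      Finset.sum_congr rfl fun κ _ => Finset.sum_congr rfl fun e _ => by rw [compVH2Ker_swap h𝓋₂ m κ _ f b b']
    rw [hT1, hT4]
    ring

/-- [folklore] **the packed family `compVh2S` over a symmetric top brick is symmetric in its two background-bond slots** (both `packVH` blocks read `compVH2Ker_swap`). -/
theorem compVh2S_swap (h𝓋₂ : ∀ m μ y g g₁ g₂, 𝓋₂ m μ y g g₂ g₁ = 𝓋₂ m μ y g g₁ g₂) (m : ℕ)
    (κ : Fin (d + 1)) (u : Site (d + 1)) (κ' : Fin (d + 1)) (u' : Site (d + 1)) :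
    compVh2S ℓ 𝓋 𝓋₂ L m κ' u' κ u = compVh2S ℓ 𝓋 𝓋₂ L m κ u κ' u' := by
  funext x z a b
  rcases a with α | ρ <;> rcases b with α' | ρ'
  · simp only [compVh2S, packVH_inl_inl]
  · simp only [compVh2S, packVH_inl_inr]
    rw [compVH2Ker_swap h𝓋₂ m _ _ (α, x) (κ, u) (κ', u')]
  · simp only [compVh2S, packVH_inr_inl]
    rw [compVH2Ker_swap h𝓋₂ m _ _ (α', z) (κ, u) (κ', u')]
  · simp only [compVh2S, packVH_inr_inr]

/-- [folklore] the JOINT block covariance of a two-bond table in `shiftK` form gives its joint PERIOD covariance on every fine box `M = N·M′`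
(C2a's bridge for bi-tables; the proof of `CombHId2W2SymSwap.fmperiodCov_of_shiftK_cov`). -/
theorem s2periodCov_of_shiftK_cov (M : Fin (d + 1) → ℕ) {M' : Fin (d + 1) → ℕ} {N : ℕ} (hM : ∀ i, M i = N * M' i)
    {S₂ : Fin (d + 1) → Site (d + 1) → Fin (d + 1) → Site (d + 1) → MKer (d + 1) (Fib d)}
    (hS₂s : ∀ (κ : Fin (d + 1)) (u : Site (d + 1)) (κ' : Fin (d + 1)) (u' t : Site (d + 1)),
      S₂ κ (u + (N : ℤ) • t) κ' (u' + (N : ℤ) • t) = shiftK (-((N : ℤ) • t)) (S₂ κ u κ' u'))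
    (κ : Fin (d + 1)) (u : Site (d + 1)) (κ' : Fin (d + 1)) (u' m x z : Site (d + 1)) (a b : Fib d) :
    S₂ κ (translate M u m) κ' (translate M u' m) (translate M x m) (translate M z m) a b = S₂ κ u κ' u' x z a b := by
  rw [translate_eq_add M u m, translate_eq_add M u' m, translate_eq_add M x m, translate_eq_add M z m, ← nsmul_per M hM m, hS₂s κ u κ' u']
  show S₂ κ u κ' u' (x + (N : ℤ) • (fun i => (M' i : ℤ) * m i) + -((N : ℤ) • fun i => (M' i : ℤ) * m i))
    (z + (N : ℤ) • (fun i => (M' i : ℤ) * m i) + -((N : ℤ) • fun i => (M' i : ℤ) * m i)) a b = S₂ κ u κ' u' x z a b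
  rw [add_neg_cancel_right, add_neg_cancel_right]

/-- [folklore] `perF M ∘ dper M` reads a kernel FIBRE-ENTRYWISE: kernels agreeing on the `(a, b)` entries have the same `((·,a),(·,b))` torus entries. -/
theorem perF_dper_apply_congr_entry (M : Fin (d + 1) → ℕ) {X Y : MKer (d + 1) (Fib d)} {a b : Fib d}
    (h : ∀ x z : Site (d + 1), X x z a b = Y x z a b) (p q : ↥(pbox M)) :
    perF M (dper M X) (p, a) (q, b) = perF M (dper M Y) (p, a) (q, b) := by
  simp only [perF_apply, perZ_apply, dper_apply, h]

end Generic

/-! ## §2 At the N record: one orientation, the torus entry, the product form -/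

section Record

variable {Lc : ℕ} [NeZero Lc] (R : Roots Lc) (P : Pins) (j : ℕ)

/-- [folklore] **PART 19's entry formula, ONE orientation** (the sym-brick composite row-border family is slot-symmetric — `compVh2S_swap` on `symVh2KerSymAt_swap` — so the
orientation average collapses: `FP/BiVertexDressSym.half_sum_vertex2OfK_of_symm`): `WN♮ μ y ν y′ x z (inr m) (inl β) = −Pn.cB(j+1) · vertex2OfK (AN R j) (Lc^(j+1)) compVh2Sˢ μ y ν y′ x z (inr m) (inl β)`. -/
theorem WN_evenHalf_apply_inr_inl_one (μ : Fin (3 + 1)) (y : Fin (3 + 1) → ℤ) (ν : Fin (3 + 1)) (y' x z : Fin (3 + 1) → ℤ) (m₁ β : Fin (3 + 1)) :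
    ((1 / 2 : ℝ) • (WN R P j μ y ν y' + sgnK (trK (WN R P j μ y ν y')))) x z (Sum.inr m₁) (Sum.inl β)
      = -(P.cB (j + 1)) * vertex2OfK (AN R j) (Lc ^ (j + 1)) (compVh2S (fun _ : ℕ => symLinKerAt (toSite R.r) Lc) (fun _ : ℕ => symVhKerAt (toSite R.r) Lc) (fun _ : ℕ => symVh2KerSymAt (toSite R.r) Lc) Lc (j + 1)) μ y ν y' x z (Sum.inr m₁) (Sum.inl β) := by
  have hsum := half_sum_vertex2OfK_of_symm (N := Lc ^ (j + 1)) (decays_AN R j)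
    (fun κ u κ' u' x z a b => abs_le_of_locStencil₂ (locStencil₂_compVh2S_symSym (one_le_of_neZero Lc) R.hr (j + 1) le_rfl) le_rfl κ u κ' u' x z a b)
    (fun κ u κ' u' => compVh2S_swap (fun _ μ y g g₁ g₂ => symVh2KerSymAt_swap (toSite R.r) Lc μ y g g₁ g₂) (j + 1) κ u κ' u') μ y ν y'
  have h := congrFun (congrFun (congrFun (congrFun hsum x) z) (Sum.inr m₁)) (Sum.inl β)
  simp only [Pi.smul_apply, Pi.add_apply, smul_eq_mul] at h
  rw [WN_evenHalf_apply_inr_inl R P j μ y ν y' x z m₁ β, h]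

variable (M : Fin (3 + 1) → ℕ) [∀ μ, NeZero (M μ)] {M' : Fin (3 + 1) → ℕ}

omit [∀ μ, NeZero (M μ)] in
/-- [folklore] **`perF_dper_wound_WN_evenHalf_inr_inl` — THE WOUND EVEN N-FAMILY's TORUS MATRIX ON THE MULTIPLIER–FIELD BLOCK** is `−Pn.cB(j+1) ·` that of the wound border
bi-vertex family (the entry formula under `Σ'_e` by `tsum_congr` + `tsum_mul_left` — no summability needed —, `perF ∘ dper` fibre-entrywise, `dper_smul ∕ perF_smul`). -/
theorem perF_dper_wound_WN_evenHalf_inr_inl (μ : Fin (3 + 1)) (y : Fin (3 + 1) → ℤ) (ν : Fin (3 + 1)) (y' : Fin (3 + 1) → ℤ)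
    (p q : ↥(pbox M)) (m₁ β : Fin (3 + 1)) :
    perF M (dper M (fun x w a b => ∑' e : Site (3 + 1),
        ((1 / 2 : ℝ) • (WN R P j μ y ν (translate M' y' e) + sgnK (trK (WN R P j μ y ν (translate M' y' e))))) x w a b)) (p, Sum.inr m₁) (q, Sum.inl β)
      = -(P.cB (j + 1)) * perF M (dper M (fun x w a b => ∑' e : Site (3 + 1),
          vertex2OfK (AN R j) (Lc ^ (j + 1)) (compVh2S (fun _ : ℕ => symLinKerAt (toSite R.r) Lc) (fun _ : ℕ => symVhKerAt (toSite R.r) Lc) (fun _ : ℕ => symVh2KerSymAt (toSite R.r) Lc) Lc (j + 1)) μ y ν (translate M' y' e) x w a b)) (p, Sum.inr m₁) (q, Sum.inl β) := by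
  have hY : ∀ x w : Site (3 + 1),
      (fun x w a b => ∑' e : Site (3 + 1), ((1 / 2 : ℝ) • (WN R P j μ y ν (translate M' y' e) + sgnK (trK (WN R P j μ y ν (translate M' y' e))))) x w a b)
          x w (Sum.inr m₁) (Sum.inl β)
        = ((-(P.cB (j + 1))) • fun x w a b => ∑' e : Site (3 + 1), vertex2OfK (AN R j) (Lc ^ (j + 1)) (compVh2S (fun _ : ℕ => symLinKerAt (toSite R.r) Lc) (fun _ : ℕ => symVhKerAt (toSite R.r) Lc) (fun _ : ℕ => symVh2KerSymAt (toSite R.r) Lc) Lc (j + 1)) μ y ν (translate M' y' e) x w a b)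
          x w (Sum.inr m₁) (Sum.inl β) := fun x w => by
    simp only [Pi.smul_apply, smul_eq_mul]
    rw [← tsum_mul_left]
    exact tsum_congr fun e => WN_evenHalf_apply_inr_inl_one R P j μ y ν (translate M' y' e) x w m₁ β
  rw [perF_dper_apply_congr_entry M hY, dper_smul, perF_smul, Matrix.smul_apply, smul_eq_mul]

/-- [folklore] **`perF_dper_wound_WN_evenHalf_inr_inl_eq_sum` — … AND IN PRODUCT FORM** (PART 14b `perF_dper_tsum_vertex2OfK_translate` at `K := AN R j`, `S₂ := compVh2Sˢ`; `M = Lc^(j+1)·M′`):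
`= −Pn.cB(j+1) · (Σ_b Σ_β Θ_b(μ,y)·Θ_β(ν,y′) • perF M (dper M (x z ↦ Σ'_n compVh2Sˢ b.2 b.1 β.2 (β.1 + M∘n) x z))) ((p, inr m), (q, inl β))`,
`Θ_b(μ,y) := perF M (AN R j) ((b.1, inl b.2), (wrapPt M (N•y), inr μ))` — road (H)'s `colN̂` and (H)'s table (by `rfl`). -/
theorem perF_dper_wound_WN_evenHalf_inr_inl_eq_sum (hM : ∀ i, M i = Lc ^ (j + 1) * M' i)
    (μ : Fin (3 + 1)) (y : Fin (3 + 1) → ℤ) (ν : Fin (3 + 1)) (y' : Fin (3 + 1) → ℤ) (p q : ↥(pbox M)) (m₁ β : Fin (3 + 1)) :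
    perF M (dper M (fun x w a b => ∑' e : Site (3 + 1),
        ((1 / 2 : ℝ) • (WN R P j μ y ν (translate M' y' e) + sgnK (trK (WN R P j μ y ν (translate M' y' e))))) x w a b)) (p, Sum.inr m₁) (q, Sum.inl β)
      = -(P.cB (j + 1)) * (∑ b : ↥(pbox M) × Fin (3 + 1), ∑ b' : ↥(pbox M) × Fin (3 + 1),
          (perF M (AN R j) (b.1, Sum.inl b.2) (wrapPt M (((Lc ^ (j + 1) : ℕ) : ℤ) • y), Sum.inr μ)
            * perF M (AN R j) (b'.1, Sum.inl b'.2) (wrapPt M (((Lc ^ (j + 1) : ℕ) : ℤ) • y'), Sum.inr ν))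
            • perF M (dper M (fun x z a c => ∑' n : Site (3 + 1),
                (compVh2S (fun _ : ℕ => symLinKerAt (toSite R.r) Lc) (fun _ : ℕ => symVhKerAt (toSite R.r) Lc) (fun _ : ℕ => symVh2KerSymAt (toSite R.r) Lc) Lc (j + 1)) b.2 (b.1 : Site (3 + 1)) b'.2 (translate M (b'.1 : Site (3 + 1)) n) x z a c)))
          (p, Sum.inr m₁) (q, Sum.inl β) := by
  obtain ⟨δK, CK, hδK, hCK, hAN⟩ := decays_AN R j
  rw [perF_dper_wound_WN_evenHalf_inr_inl R P j M μ y ν y' p q m₁ β,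
    perF_dper_tsum_vertex2OfK_translate M hM (translate_inv_AN R j M hM) hAN hCK hδK
      (locStencil₂_compVh2S_symSym (one_le_of_neZero Lc) R.hr (j + 1) hδK.le)
      (fun κ u κ' u' m x z a b => s2periodCov_of_shiftK_cov M hM
        (fun κ u κ' u' t => compVh2S_symSym_translate (ρ := toSite R.r) (one_le_of_neZero Lc) (j + 1) κ u κ' u' t) κ u κ' u' m x z a b)
      μ y ν y']

end Record

end Summit.QuantumFields.BalabanUV.Beta.NVertexEvenBorderTorus

end
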